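import Literature.Geometry.Riemannian.VolumeSphereTheoremProofs
import HarnessLib

/-!
# The analytic core of the null focusing theorem: Raychaudhuri comparison for Jacobi tensors

Layer L4 (existence of focal points of spacelike `2`-surfaces along null normal geodesics under
the null energy condition; O'Neill 1983, Ch. 10, Prop. 43; Hawking–Ellis 1973, §4.4,
Prop. 4.4.6) of the proof programme of `Literature.Geometry.Lorentzian.ChruscielEtAl2001_areaTheorem`
(Chruściel–Delay–Galloway–Howard 2001, Prop. 4.17: "`S` has a focal point along `Γ` at finite
affine distance … by well known results [O'Neill]") and, equally, of "half 2" of the Penrose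
singularity theorem (`Literature.Geometry.Lorentzian.PenroseSingularityTheoremProofs`).

We follow the **Raychaudhuri / optical-equation route** (Chruściel–Delay–Galloway–Howard 2001,
§5, (5.1)–(5.2): the null Weingarten map `b` of a smooth null hypersurface satisfies the Riccati
equation `b' + b² + R = 0`, whose trace is the Raychaudhuri equation
`θ' = -Ric(η', η') - σ² - θ²/(n-2)`; Hawking–Ellis 1973, (4.35) and Prop. 4.4.6) rather than
O'Neill's index form, because the tree already holds the complete matrix Jacobi/Riccati layer of
Bishop's comparison theorem (`Literature.Geometry.Riemannian.VolumeSphereTheoremProofs`, §8, after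
Chavel 2006, Thm. III.4.3): for matrix curves with `A' = A₁`, `A₁' = -R A`, the shape operator
`U = A₁ A⁻¹` satisfies `U' + U² + R = 0` (`hasDerivAt_shape_riccati`), is symmetric when the
Wronskian `A₁ᵀ A - Aᵀ A₁` vanishes (`isSymm_mul_inv_of_wronskian_eq_zero`), and then
`(tr U)' + (tr U)²/m + tr R ≤ 0` (`trace_shape_riccati_le`, `m` the size of the matrices). In
the null setting `A` is the screen part of the Jacobi tensor of the congruence of null normal
geodesics issuing from a spacelike surface of codimension two, written in a parallel orthonormal
screen frame (so `m = n - 2 = 2` in `3 + 1` dimensions), `tr U = θ` is the null expansion and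
`tr R = Ric(γ', γ')`. This file supplies the three purely analytic facts the geometric assembly
(`NullFocusing.lean`, to follow) consumes:

* `le_div_of_hasDerivAt_le_neg_sq_div` — **the scalar Raychaudhuri comparison**: if
  `θ' ≤ -θ²/d` on `[0, b)` and `θ(0) < 0` then `b ≤ d/(-θ(0))` (Hawking–Ellis 1973, proof of
  Prop. 4.4.4/4.4.6: "`θ̂` will become infinite within an affine distance `2/(-θ̂₁)`"); the
  standard proof, `(1/θ - t/d)' ≥ 0` and `1/θ < 0`;
* `exists_hasDerivAt_trace_shape_le` — **the local Riccati inequality** for `tr (A₁ A⁻¹)` at a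
  parameter where `det A ≠ 0` and the Wronskian vanishes (pointwise hypotheses only, so that it
  can be fed by LOCAL parallel frames along a long geodesic);
* `hasDerivAt_det_transpose_mul_self` — `(det AᵀA)' = 2 tr(A₁A⁻¹) det AᵀA`: the Gram determinant
  `det AᵀA` of the screen Jacobi fields is frame independent, and `θ = (det AᵀA)'/(2 det AᵀA)`;
* `exists_hasDerivAt_logDeriv_gram_le` — the two combined and transported to any function `D`
  agreeing with `det AᵀA` near the parameter: `θ := D'/(2D)` is differentiable there with
  `θ' + θ²/m + tr R ≤ 0`.

No geometry, no definitions, no named facts (D-0026).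

## References

* S. W. Hawking, G. F. R. Ellis, *The large scale structure of space-time*, CUP 1973, §4.4,
  (4.35), Props. 4.4.4–4.4.6.
* B. O'Neill, *Semi-Riemannian geometry with applications to relativity*, Academic Press 1983,
  Ch. 10, Prop. 43 (p. 290).
* P. T. Chruściel, E. Delay, G. J. Galloway, R. Howard, *Regularity of horizons and the area
  theorem*, Ann. Henri Poincaré 2 (2001) 109–178, §5, (5.1)–(5.2); Prop. 4.17.
* I. Chavel, *Riemannian geometry: a modern introduction*, 2nd ed., CUP 2006, Thm. III.4.3.
-/

noncomputable section

open Set Filter Topology Matrix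

namespace Literature.Geometry.Lorentzian

open Literature.Geometry.Riemannian

/-! ### The scalar Raychaudhuri comparison -/

/-- **The scalar Raychaudhuri comparison (focusing lemma).** If `θ` is differentiable on
`[0, b)` with `θ' ≤ -θ²/d` there (`d > 0`) and `θ(0) < 0`, then `b ≤ d/(-θ(0))` — i.e. a solution
of the Raychaudhuri inequality with negative initial expansion cannot stay finite beyond affine
parameter `d/|θ(0)|` (Hawking–Ellis 1973, proof of Prop. 4.4.4: "`θ̂` will become infinite
within an affine distance `2/(-θ̂₁)`"; `d = n - 2 = 2` there). Proof: `θ` is nonincreasing, hence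
negative, on `[0, b)`; `ψ = 1/θ - t/d` has `ψ' = -θ'/θ² - 1/d ≥ 0`, so
`1/θ(0) + t/d ≤ 1/θ(t) < 0` for all `t < b`. [cite: HawkingEllis1973CUP, §4.4, Prop. 4.4.4 (proof) and Prop. 4.4.6] -/
theorem le_div_of_hasDerivAt_le_neg_sq_div {θ θ' : ℝ → ℝ} {b d : ℝ} (hd : 0 < d)
    (hθ : ∀ t ∈ Ico 0 b, HasDerivAt θ (θ' t) t)
    (hle : ∀ t ∈ Ico 0 b, θ' t ≤ -(θ t) ^ 2 / d) (h0 : θ 0 < 0) :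
    b ≤ d / (-θ 0) := by
  by_contra hb
  push Not at hb
  have hθ0 : 0 < -θ 0 := neg_pos.2 h0
  have hc : 0 < d / (-θ 0) := div_pos hd hθ0
  have hb0 : 0 < b := hc.trans hb
  -- `θ` is nonincreasing on `[0, b)`, hence negative there
  have hcont : ContinuousOn θ (Ico 0 b) := fun t ht ↦ (hθ t ht).continuousAt.continuousWithinAt
  have hanti : AntitoneOn θ (Ico 0 b) := by
    refine antitoneOn_of_deriv_nonpos (convex_Ico 0 b) hcont ?_ ?_
    · intro t ht
      rw [interior_Ico] at ht
      exact (hθ t (Ioo_subset_Ico_self ht)).differentiableAt.differentiableWithinAt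
    · intro t ht
      rw [interior_Ico] at ht
      have ht' := Ioo_subset_Ico_self ht
      rw [(hθ t ht').deriv]
      have h2 : 0 ≤ (θ t) ^ 2 / d := div_nonneg (sq_nonneg _) hd.le
      have h3 := hle t ht'
      rw [neg_div] at h3
      linarith
  have hneg : ∀ t ∈ Ico 0 b, θ t < 0 := fun t ht ↦
    lt_of_le_of_lt (hanti (left_mem_Ico.2 hb0) ht ht.1) h0
  -- `ψ = 1/θ - t/d` is nondecreasing on `[0, b)`
  set ψ : ℝ → ℝ := fun t ↦ (θ t)⁻¹ - t / d with hψ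
  have hψd : ∀ t ∈ Ico 0 b, HasDerivAt ψ (-(θ' t) / (θ t) ^ 2 - 1 / d) t := fun t ht ↦
    ((hθ t ht).inv (hneg t ht).ne).sub ((hasDerivAt_id t).div_const d)
  have hψnonneg : ∀ t ∈ Ico 0 b, 0 ≤ -(θ' t) / (θ t) ^ 2 - 1 / d := by
    intro t ht
    have hθt := hneg t ht
    have hsq : 0 < (θ t) ^ 2 := by rw [sq]; exact mul_pos_of_neg_of_neg hθt hθt
    have h1 : (θ t) ^ 2 / d ≤ -(θ' t) := by
      have h3 := hle t ht
      rw [neg_div] at h3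
      linarith
    have h2 : 1 / d ≤ -(θ' t) / (θ t) ^ 2 := by
      rw [div_le_div_iff₀ hd hsq, one_mul]
      calc (θ t) ^ 2 = (θ t) ^ 2 / d * d := by field_simp
        _ ≤ -(θ' t) * d := by gcongr
    linarith
  have hψcont : ContinuousOn ψ (Ico 0 b) := fun t ht ↦ (hψd t ht).continuousAt.continuousWithinAt
  have hmono : MonotoneOn ψ (Ico 0 b) := by
    refine monotoneOn_of_deriv_nonneg (convex_Ico 0 b) hψcont ?_ ?_
    · intro t ht
      rw [interior_Ico] at ht
      exact (hψd t (Ioo_subset_Ico_self ht)).differentiableAt.differentiableWithinAt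
    · intro t ht
      rw [interior_Ico] at ht
      have ht' := Ioo_subset_Ico_self ht
      rw [(hψd t ht').deriv]
      exact hψnonneg t ht'
  -- evaluate at `t = d/(-θ 0) ∈ [0, b)`
  set t := d / (-θ 0) with ht_def
  have htI : t ∈ Ico 0 b := ⟨hc.le, hb⟩
  have hkey : ψ 0 ≤ ψ t := hmono (left_mem_Ico.2 hb0) htI hc.le
  have hψ0 : ψ 0 = (θ 0)⁻¹ := by simp [hψ]
  have hψt : ψ t < -(t / d) := by
    have : (θ t)⁻¹ < 0 := inv_lt_zero.2 (hneg t htI)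
    simp only [hψ]
    linarith
  have htd : t / d = (-θ 0)⁻¹ := by
    rw [ht_def]
    field_simp
  rw [hψ0] at hkey
  rw [htd] at hψt
  have : (θ 0)⁻¹ < -(-θ 0)⁻¹ := lt_of_le_of_lt hkey hψt
  rw [inv_neg, neg_neg] at this
  exact lt_irrefl _ this

/-- **Existence of a zero of `D` from the Raychaudhuri comparison** (the form used by the
assembly): let `D` be continuous on `[0, c]` with `D(0) ≠ 0`, and suppose that on every initial
segment `[0, b)`, `b ≤ c`, free of zeros of `D` a function `θ` satisfies `θ' ≤ -θ²/d` (`d > 0`),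
where `θ(0) < 0` and `d/(-θ(0)) < c`. Then `D` vanishes somewhere in `(0, d/(-θ(0))]`. (If not,
the first zero `b` of `D` in `[0, c]` — or `b = c` if there is none — exceeds `d/(-θ 0)`, and
`le_div_of_hasDerivAt_le_neg_sq_div` on `[0, b)` gives `b ≤ d/(-θ 0)`.) In the application `D` is
the Gram determinant of the screen Jacobi fields along a null normal geodesic and `θ = D'/(2D)`
the null expansion: a focal point occurs within affine distance `2/|θ(0)|`.
[cite: HawkingEllis1973CUP, §4.4, Prop. 4.4.6] [cite: ONeillSemiRiemannian1983, Ch. 10, Prop. 43] -/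
theorem exists_eq_zero_of_raychaudhuri {D θ θ' : ℝ → ℝ} {c d : ℝ} (hd : 0 < d)
    (hDc : ContinuousOn D (Icc 0 c)) (hD0 : D 0 ≠ 0) (h0 : θ 0 < 0) (hc : d / (-θ 0) < c)
    (hθ : ∀ b ≤ c, (∀ t ∈ Ico 0 b, D t ≠ 0) → ∀ t ∈ Ico 0 b, HasDerivAt θ (θ' t) t)
    (hle : ∀ b ≤ c, (∀ t ∈ Ico 0 b, D t ≠ 0) → ∀ t ∈ Ico 0 b, θ' t ≤ -(θ t) ^ 2 / d) :
    ∃ t ∈ Ioc 0 (d / (-θ 0)), D t = 0 := by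
  by_contra hne
  push Not at hne
  have hθ0 : 0 < -θ 0 := neg_pos.2 h0
  have hT : 0 < d / (-θ 0) := div_pos hd hθ0
  -- no zero of `D` on `[0, d/(-θ 0)]`
  have hnoz : ∀ t ∈ Icc 0 (d / (-θ 0)), D t ≠ 0 := by
    intro t ht
    rcases ht.1.eq_or_lt with h | h
    · rw [← h]; exact hD0
    · exact hne t ⟨h, ht.2⟩
  -- the zero set of `D` in `[0, c]`
  set Z : Set ℝ := Icc 0 c ∩ D ⁻¹' {0} with hZ
  have hZc : IsClosed Z := hDc.preimage_isClosed_of_isClosed isClosed_Icc isClosed_singleton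
  rcases Z.eq_empty_or_nonempty with hZe | hZne
  · -- no zero at all: compare on `[0, c)`
    have hDne : ∀ t ∈ Ico 0 c, D t ≠ 0 := by
      intro t ht hDt
      have : t ∈ Z := ⟨Ico_subset_Icc_self ht, hDt⟩
      rw [hZe] at this
      exact this
    have key := le_div_of_hasDerivAt_le_neg_sq_div hd (hθ c le_rfl hDne) (hle c le_rfl hDne) h0
    exact absurd key (not_le.2 hc)
  · -- the first zero `b = inf Z`
    set b := sInf Z with hb
    have hbdd : BddBelow Z := ⟨0, fun t ht ↦ ht.1.1⟩
    have hbZ : b ∈ Z := hZc.csInf_mem hZne hbdd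
    have hbc : b ≤ c := hbZ.1.2
    have hDne : ∀ t ∈ Ico 0 b, D t ≠ 0 := by
      intro t ht hDt
      have htZ : t ∈ Z := ⟨⟨ht.1, ht.2.le.trans hbc⟩, hDt⟩
      exact absurd (csInf_le hbdd htZ) (not_le.2 ht.2)
    have key := le_div_of_hasDerivAt_le_neg_sq_div hd (hθ b hbc hDne) (hle b hbc hDne) h0
    -- but `b` is a zero of `D`, so `b > d/(-θ 0)`
    have hbT : d / (-θ 0) < b := by
      by_contra h
      push Not at h
      exact hnoz b ⟨hbZ.1.1, h⟩ hbZ.2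
    exact absurd key (not_le.2 hbT)

/-! ### The local matrix Riccati inequality with a Wronskian hypothesis -/

section Matrices

open scoped Matrix.Norms.Operator

variable {ι : Type*} [Fintype ι] [DecidableEq ι]

/-- **The local Riccati inequality for the expansion.** At a parameter `t` where the matrix
curves satisfy `A' = A₁`, `A₁' = -R A`, where `det A(t) ≠ 0` and the Wronskian vanishes,
`A₁(t)ᵀ A(t) = A(t)ᵀ A₁(t)`, the expansion `θ = tr (A₁ A⁻¹)` is differentiable with
`θ' + θ²/m + tr R(t) ≤ 0`, `m = card ι` — the traced optical (Riccati) equation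
`θ' = -Ric - |b|²` with the Cauchy–Schwarz step `|b|² ≥ θ²/m` for the symmetric null Weingarten
map `b = A₁ A⁻¹` (Chruściel–Delay–Galloway–Howard 2001, §5, (5.1)–(5.2); the matrix layer is
`hasDerivAt_trace_shape`, `isSymm_mul_inv_of_wronskian_eq_zero`, `trace_shape_riccati_le` of
`VolumeSphereTheoremProofs.lean`, Chavel 2006, Thm. III.4.3). Pointwise hypotheses only.
[cite: ChruscielEtAl2001, §5, (5.1)–(5.2)] [cite: Chavel2006, Thm. III.4.3 (III.4.16)–(III.4.18)] -/
theorem exists_hasDerivAt_trace_shape_le [Nonempty ι] {A A₁ R : ℝ → Matrix ι ι ℝ} {t : ℝ}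
    (hA : HasDerivAt A (A₁ t) t) (hA₁ : HasDerivAt A₁ (-(R t * A t)) t)
    (hdet : (A t).det ≠ 0) (hW : (A₁ t)ᵀ * A t = (A t)ᵀ * A₁ t) :
    ∃ φ' : ℝ, HasDerivAt (fun s ↦ (A₁ s * (A s)⁻¹).trace) φ' t ∧
      φ' + (A₁ t * (A t)⁻¹).trace ^ 2 / Fintype.card ι + (R t).trace ≤ 0 := by
  have hunit : IsUnit (A t).det := isUnit_iff_ne_zero.2 hdet
  exact ⟨_, hasDerivAt_trace_shape hA hA₁ hunit,
    trace_shape_riccati_le (isSymm_mul_inv_of_wronskian_eq_zero hW hunit) rfl⟩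

/-- **Derivative of the Gram determinant**: along matrix curves with `A' = A₁`, where
`det A(t) ≠ 0`, `(det (Aᵀ A))' = 2 tr(A₁ A⁻¹) det (Aᵀ A)` (Jacobi's formula
`(det A)' = tr(A₁A⁻¹) det A`, `hasDerivAt_det_jacobi`, and `det AᵀA = (det A)²`). In a parallel
orthonormal screen frame `Aᵀ A` is the Gram matrix of the screen Jacobi fields, a frame
independent quantity, and `tr(A₁A⁻¹) = θ` the null expansion: `θ = (det AᵀA)'/(2 det AᵀA)`.
[cite: Chavel2006, Thm. III.4.3 (proof: `(det 𝒜)'/det 𝒜 = tr 𝒜'𝒜⁻¹`)] -/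
theorem hasDerivAt_det_transpose_mul_self {A A₁ : ℝ → Matrix ι ι ℝ} {t : ℝ}
    (hA : HasDerivAt A (A₁ t) t) (hdet : (A t).det ≠ 0) :
    HasDerivAt (fun s ↦ ((A s)ᵀ * A s).det)
      (2 * (A₁ t * (A t)⁻¹).trace * ((A t)ᵀ * A t).det) t := by
  have h1 : (fun s ↦ ((A s)ᵀ * A s).det) = fun s ↦ (A s).det ^ 2 := by
    funext s
    rw [Matrix.det_mul, Matrix.det_transpose, sq]
  rw [h1, Matrix.det_mul, Matrix.det_transpose]
  have h2 := (hasDerivAt_det_jacobi hA hdet).pow 2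
  refine h2.congr_deriv ?_
  push_cast
  ring

/-- **The expansion as a logarithmic derivative of the Gram determinant, and its Riccati
inequality.** Let the matrix curves satisfy `A' = A₁` near `t` and `A₁' = -R A` at `t`, with
`det A(t) ≠ 0` and vanishing Wronskian at `t`, and let `D` be any real function agreeing with
`det (Aᵀ A)` near `t`. Then `θ := D'/(2D)` (with Mathlib's `deriv`) is differentiable at `t` and
`θ'(t) + θ(t)²/m + tr R(t) ≤ 0`, `m = card ι`. This is the frame-independent, pointwise form of
the Raychaudhuri inequality consumed by the null focusing theorem: `D` is the (globally defined)
Gram determinant of the screen Jacobi fields and `A` its expression in a LOCAL parallel screen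
frame. [cite: ChruscielEtAl2001, §5, (5.2)] [cite: HawkingEllis1973CUP, §4.4, (4.35)] -/
theorem exists_hasDerivAt_logDeriv_gram_le [Nonempty ι] {A A₁ R : ℝ → Matrix ι ι ℝ}
    {D : ℝ → ℝ} {t : ℝ} (hA : ∀ᶠ s in 𝓝 t, HasDerivAt A (A₁ s) s)
    (hA₁ : HasDerivAt A₁ (-(R t * A t)) t) (hdet : (A t).det ≠ 0)
    (hW : (A₁ t)ᵀ * A t = (A t)ᵀ * A₁ t) (hD : ∀ᶠ s in 𝓝 t, D s = ((A s)ᵀ * A s).det) :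
    ∃ φ' : ℝ, HasDerivAt (fun s ↦ deriv D s / (2 * D s)) φ' t ∧
      φ' + (deriv D t / (2 * D t)) ^ 2 / Fintype.card ι + (R t).trace ≤ 0 := by
  -- `det A ≠ 0` near `t`
  have hAt : HasDerivAt A (A₁ t) t := hA.self_of_nhds
  have hdet' : ∀ᶠ s in 𝓝 t, (A s).det ≠ 0 := by
    have hc : Continuous fun M : Matrix ι ι ℝ ↦ M.det := continuous_id.matrix_det
    exact (hc.continuousAt.comp hAt.continuousAt).eventually_ne hdet
  -- near `t`: `D' = 2 tr(A₁A⁻¹) det AᵀA` and `D = det AᵀA ≠ 0`, so `D'/(2D) = tr(A₁A⁻¹)`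
  have heq : (fun s ↦ deriv D s / (2 * D s)) =ᶠ[𝓝 t] fun s ↦ (A₁ s * (A s)⁻¹).trace := by
    filter_upwards [hA, hdet', hD.eventually_nhds] with s hs hds hDs
    have hDs' : HasDerivAt D (2 * (A₁ s * (A s)⁻¹).trace * ((A s)ᵀ * A s).det) s :=
      (hasDerivAt_det_transpose_mul_self hs hds).congr_of_eventuallyEq hDs
    rw [hDs'.deriv, hDs.self_of_nhds]
    have hne : ((A s)ᵀ * A s).det ≠ 0 := by
      rw [Matrix.det_mul, Matrix.det_transpose]
      exact mul_ne_zero hds hds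
    field_simp
  obtain ⟨φ', hφ', hle⟩ := exists_hasDerivAt_trace_shape_le hAt hA₁ hdet hW
  refine ⟨φ', hφ'.congr_of_eventuallyEq heq, ?_⟩
  have hval : deriv D t / (2 * D t) = (A₁ t * (A t)⁻¹).trace := heq.self_of_nhds
  rw [hval]
  exact hle

end Matrices

end Literature.Geometry.Lorentzian

end
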